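import Mathlib
import Literature.MathematicalPhysics.QuantumLattice.AngularSectors
import Literature.MathematicalPhysics.QuantumLattice.HubbardFermiCurve
import Literature.MathematicalPhysics.QuantumLattice.HubbardBandSectorCountingCounts
import Summits.HubbardSuperconductivity.HubbardSuperconductivity.Theses.KLProgramme
import HarnessLib

/-!
# Route KLProgramme — crux K1 `H10TwoPointLimit`: the `2n`-leg isotropic sector count modulo `2πℤ²`
(DECOMP App. F, Corollary F.3) FROM the support item `CountPairsOffset`

Helper for stub `stub_H10_mu_of_count : CountPairsOffset → H10AnalysisWindow` of the registered skeleton of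
K1 (stmt-HubbardSuperconductivity-19938): the sector-language form of the arbitrary-offset pair count, i.e.
the `2n`-leg analogue of the tree's four-sector lemma `stub_fourSectorCount`
(`ThermalWedgeTwSourcedInertnessFourSectorCount.lean`; Benfatto–Giuliani–Mastropietro 2006 Lemma 3.1 /
App. A2 (A2.0), used at every leg number in (2.76)/(2.80)). For a vertex with `m + 3` legs on the shell
`|ε - μ| ≤ π/2ⁿ` of the band `ε(k) = -2(cos k₁ + cos k₂)`, momentum conserved modulo a reciprocal vector
`2πG`, with the sectors of `m` legs FIXED, the number of sector triples for the remaining three legs that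
admit compatible momenta is `≤ K · 2ⁿ · (n + 1)`, `K = K(μ₁, μ₂, m)` uniform in `n`, `G`, the fixed sectors
and `μ ∈ [μ₁, μ₂] ⊂ (-4, 0)` (`h10_twoNSectorCount_of_countPairsOffset`, conditional on the route decl
`CountPairsOffset`; unconditional once item stmt-HubbardSuperconductivity-20036 is closed).

Proof (the tree's, with the first curve point replaced by the offset `P₀ = Σ_fixed p(θ_ω) - 2πG`):
cell geometry (`BandSectorCounting.cell`: a shell momentum in sector `ω` is within `D w` of `p(θ_ω)`),
elimination of the last index (`card_grid_in_box_le`, `card_prod3_le`, and `h10_abs_offsetLevel_le_of_sum`: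
if `p(θ_d)` completes `P₀ + p(θ_a) + p(θ_c)` to `0` within `r` then `|ε₂(P₀ + p(θ_a) + p(θ_c)) - μ| ≤ 4r`),
then `CountPairsOffset` at tolerance `C_δ = 4(m+3)D`; coarse scales are absorbed by the trivial bound `N³`.
-/

open Classical

noncomputable section

-- the tree's namespace `Summit.<Summit>.<Problem>.Theorems` repeats the summit name by design (D-0017)
set_option linter.dupNamespace false

open Real Set
open Literature.MathematicalPhysics.QuantumLattice
open Literature.MathematicalPhysics.QuantumLattice.BandSectorCounting

namespace Summit.HubbardSuperconductivity.HubbardSuperconductivity.Theorems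

/-- **From the sum condition to the offset level function**: if `p(θ_d)` completes `P + p(θ_a) + p(θ_c)` to
`0` within `r` (coordinatewise) then `|ε₂(P + p(θ_a) + p(θ_c)) - μ| ≤ 4r` (`ε₂` is `2`-Lipschitz in each
coordinate and `ε₂(-p(θ_d)) = μ`). -/
theorem h10_abs_offsetLevel_le_of_sum {a b : ℝ} (B : BandBounds a b) {μ : ℝ} (hμ : μ ∈ Icc a b)
    {P : ℝ × ℝ} {θa θc θd r : ℝ}
    (hx : |P.1 + bandX μ θa + bandX μ θc + bandX μ θd| ≤ r)
    (hy : |P.2 + bandY μ θa + bandY μ θc + bandY μ θd| ≤ r) :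
    |eps2 (P.1 + bandX μ θa + bandX μ θc) (P.2 + bandY μ θa + bandY μ θc) - μ| ≤ 4 * r := by
  obtain ⟨h1, h2⟩ := B.level hμ
  set e₀ := P.1 + bandX μ θa + bandX μ θc + bandX μ θd with he₀
  set e₁ := P.2 + bandY μ θa + bandY μ θc + bandY μ θd with he₁
  have hSX : P.1 + bandX μ θa + bandX μ θc = -bandX μ θd + e₀ := by rw [he₀]; ring
  have hSY : P.2 + bandY μ θa + bandY μ θc = -bandY μ θd + e₁ := by rw [he₁]; ring
  have hμ4 : eps2 (-bandX μ θd) (-bandY μ θd) = μ := by rw [eps2_neg]; exact eps2_bandXY h1 h2 θd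
  rw [hSX, hSY]
  have hrw : eps2 (-bandX μ θd + e₀) (-bandY μ θd + e₁) - μ =
      eps2 (-bandX μ θd + e₀) (-bandY μ θd + e₁) - eps2 (-bandX μ θd) (-bandY μ θd) := by rw [hμ4]
  rw [hrw]
  calc |eps2 (-bandX μ θd + e₀) (-bandY μ θd + e₁) - eps2 (-bandX μ θd) (-bandY μ θd)|
      ≤ 2 * (|(-bandX μ θd + e₀) - (-bandX μ θd)| + |(-bandY μ θd + e₁) - (-bandY μ θd)|) := abs_eps2_sub_eps2_le _ _ _ _
    _ = 2 * (|e₀| + |e₁|) := by ring_nf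
    _ ≤ 4 * r := by linarith

set_option maxHeartbeats 800000 in
/-- **The `2n`-leg isotropic sector count modulo `2πℤ²` (DECOMP App. F Cor. F.3), from `CountPairsOffset`.**
For every level window `[μ₁, μ₂] ⊂ (-4, 0)` and every number `m` of fixed legs there is `K > 0` such that for
all `μ ∈ [μ₁, μ₂]`, all scales `n`, all reciprocal vectors `G ∈ ℤ²` and all fixed sector indices
`ω_f : Fin m → ℕ`: the number of sector triples `(ω_a, ω_b, ω_c)` (angular width `π/2ⁿ`) for which momenta of the
shell `|ε - μ| ≤ π/2ⁿ` in the `m` fixed sectors and in `ω_a, ω_b, ω_c` can satisfy `Σ k = 2πG` exactly is at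
most `K · 2ⁿ · (n + 1)` — Benfatto–Giuliani–Mastropietro's `Cγ^{-h}|h|` at EVERY leg number `m + 3`, on the
whole hole-doped band, umklapp included (the first `m` legs enter only through the offset
`Σ_fixed p(θ_ω) - 2πG` of the route's support item `CountPairsOffset`, stmt-HubbardSuperconductivity-20036). -/
theorem h10_twoNSectorCount_of_countPairsOffset
    (hC : Summit.HubbardSuperconductivity.HubbardSuperconductivity.Theses.KLProgramme.CountPairsOffset) :
    ∀ μ₁ μ₂ : ℝ, -4 < μ₁ → μ₁ ≤ μ₂ → μ₂ < 0 → ∀ m : ℕ, ∃ K : ℝ, 0 < K ∧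
      ∀ μ ∈ Set.Icc μ₁ μ₂, ∀ (n : ℕ) (G : Fin 2 → ℤ) (ωf : Fin m → ℕ),
        (((Finset.univ : Finset (Fin (sectorCount n) × Fin (sectorCount n) × Fin (sectorCount n))).filter
          (fun ω : Fin (sectorCount n) × Fin (sectorCount n) × Fin (sectorCount n) =>
            ∃ (kf : Fin m → Fin 2 → ℝ) (k : Fin 3 → Fin 2 → ℝ),
            (∀ j i, |kf j i| < Real.pi) ∧ (∀ l i, |k l i| < Real.pi) ∧
            (∀ j, |sqDispersion (kf j) - μ| ≤ sectorWidth n) ∧ (∀ l, |sqDispersion (k l) - μ| ≤ sectorWidth n) ∧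
            (∀ j, sectorIndex n (Complex.arg (⟨kf j 0, kf j 1⟩ : ℂ)) = ωf j) ∧
            sectorIndex n (Complex.arg (⟨k 0 0, k 0 1⟩ : ℂ)) = (ω.1 : ℕ) ∧
            sectorIndex n (Complex.arg (⟨k 1 0, k 1 1⟩ : ℂ)) = (ω.2.1 : ℕ) ∧
            sectorIndex n (Complex.arg (⟨k 2 0, k 2 1⟩ : ℂ)) = (ω.2.2 : ℕ) ∧
            (∀ i, (∑ j, kf j i) + (∑ l, k l i) = 2 * Real.pi * (G i : ℝ)))).card : ℝ) ≤
          K * 2 ^ n * ((n : ℝ) + 1) := by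
  intro μ₁ μ₂ hμ₁ h12 hμ₂ m
  -- the level range `[a', b']` and its uniform bounds
  have ha : -4 < (μ₁ - 4) / 2 := by linarith
  have hab : (μ₁ - 4) / 2 ≤ μ₂ / 2 := by linarith
  have hb : μ₂ / 2 < 0 := by linarith
  obtain ⟨B, -⟩ : ∃ B : BandBounds ((μ₁ - 4) / 2) (μ₂ / 2), B = bandBounds ha hab hb := ⟨_, rfl⟩
  have hm₀ : 0 < min (μ₁ - (μ₁ - 4) / 2) (μ₂ / 2 - μ₂) := lt_min (by linarith) (by linarith)
  set m₀ := min (μ₁ - (μ₁ - 4) / 2) (μ₂ / 2 - μ₂) with hm₀def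
  have hD := B.Dcell_pos
  have hum := B.umin_pos
  have hπ := Real.pi_pos
  -- the tolerance constant `C_δ = 4 (m+3) D` and the count
  obtain ⟨Cδ, hCδ⟩ : ∃ Cδ : ℝ, Cδ = 4 * (((m : ℝ) + 3) * B.Dcell) := ⟨_, rfl⟩
  have hCδpos : 0 < Cδ := by rw [hCδ]; positivity
  obtain ⟨Kp, hKp, hcount⟩ := hC ((μ₁ - 4) / 2) (μ₂ / 2) ha hab hb m₀ Cδ hm₀ hCδpos
  -- the threshold on `w` and the two constants
  obtain ⟨w₀, hw₀⟩ : ∃ w₀ : ℝ, w₀ = min 1 (min m₀ (m₀ / (2 * Cδ))) := ⟨_, rfl⟩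
  have hw₀pos : 0 < w₀ := by rw [hw₀]; exact lt_min (by norm_num) (lt_min hm₀ (by positivity))
  obtain ⟨C₀, hC₀⟩ : ∃ C₀ : ℝ, C₀ = 3 * (2 * (π * (Real.sqrt 2 * (((m : ℝ) + 3) * B.Dcell) / B.umin)) + 1) := ⟨_, rfl⟩
  have hC₀pos : 0 < C₀ := by rw [hC₀]; positivity
  obtain ⟨K₁, hK₁⟩ : ∃ K₁ : ℝ, K₁ = 8 * (π / w₀) ^ 2 := ⟨_, rfl⟩
  obtain ⟨K₂, hK₂⟩ : ∃ K₂ : ℝ, K₂ = C₀ * Kp * 3 / π := ⟨_, rfl⟩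
  have hK₁pos : 0 < K₁ := by rw [hK₁]; positivity
  have hK₂pos : 0 < K₂ := by rw [hK₂]; positivity
  refine ⟨K₁ + K₂, by positivity, ?_⟩
  intro μ hμ n G ωf
  have hwpos : 0 < sectorWidth n := sectorWidth_pos n
  have hNw : (sectorCount n : ℝ) * sectorWidth n = 2 * π := sectorCount_mul_sectorWidth n
  have h2n : (2 : ℝ) ^ n * sectorWidth n = π := by rw [sectorWidth]; field_simp
  have hNeq : sectorCount n = 2 * 2 ^ n := by unfold sectorCount; ring
  have hNreal : (sectorCount n : ℝ) = 2 * 2 ^ n := by rw [hNeq]; push_cast; ring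
  have hsc : ∀ i : ℕ, sectorCenter n i = sectorWidth n / 2 + i * sectorWidth n := sectorCenter_eq n
  generalize hwdef : sectorWidth n = w at hwpos hNw h2n hsc ⊢
  have hμab : μ ∈ Icc ((μ₁ - 4) / 2) (μ₂ / 2) := ⟨by linarith only [hμ.1, hμ₁], by linarith only [hμ.2, hμ₂]⟩
  have h2npos : (0 : ℝ) < 2 ^ n := by positivity
  -- the offset `P₀ = Σ_fixed p(θ_ω) - 2πG`
  set P₀ : ℝ × ℝ := (∑ j, bandX μ (w / 2 + (ωf j : ℝ) * w) - 2 * π * (G 0 : ℝ),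
    ∑ j, bandY μ (w / 2 + (ωf j : ℝ) * w) - 2 * π * (G 1 : ℝ)) with hP₀
  -- the trivial bound `N³`
  have htriv : ∀ (pr : Fin (sectorCount n) × Fin (sectorCount n) × Fin (sectorCount n) → Prop) [DecidablePred pr],
      ((((Finset.univ : Finset (Fin (sectorCount n) × Fin (sectorCount n) × Fin (sectorCount n))).filter pr).card : ℝ)) ≤ (sectorCount n : ℝ) ^ 3 := by
    intro pr _
    have h1 := Finset.card_filter_le (Finset.univ : Finset (Fin (sectorCount n) × Fin (sectorCount n) × Fin (sectorCount n))) pr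
    rw [Finset.card_univ, Fintype.card_prod, Fintype.card_prod, Fintype.card_fin] at h1
    have : ((((Finset.univ : Finset (Fin (sectorCount n) × Fin (sectorCount n) × Fin (sectorCount n))).filter pr).card : ℝ)) ≤
        ((sectorCount n * (sectorCount n * sectorCount n) : ℕ) : ℝ) := by exact_mod_cast h1
    calc _ ≤ ((sectorCount n * (sectorCount n * sectorCount n) : ℕ) : ℝ) := this
      _ = (sectorCount n : ℝ) ^ 3 := by push_cast; ring
  by_cases hwle : w ≤ w₀
  · -- the main case
    have hw1 : w ≤ 1 := hwle.trans (by rw [hw₀]; exact min_le_left _ _)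
    have hwm : w ≤ m₀ := hwle.trans (by rw [hw₀]; exact (min_le_right _ _).trans (min_le_left _ _))
    have hwη : w ≤ m₀ / (2 * Cδ) := hwle.trans (by rw [hw₀]; exact (min_le_right _ _).trans (min_le_right _ _))
    have h2δ : Cδ * w ≤ m₀ / 2 := by
      have := mul_le_mul_of_nonneg_left hwη hCδpos.le
      have e : Cδ * (m₀ / (2 * Cδ)) = m₀ / 2 := by field_simp
      rw [e] at this; exact this
    have hm1 : m₀ ≤ μ₁ - (μ₁ - 4) / 2 := min_le_left _ _
    have hm2 : m₀ ≤ μ₂ / 2 - μ₂ := min_le_right _ _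
    have hlo : (μ₁ - 4) / 2 ≤ μ - m₀ := by linarith only [hμ.1, hm1]
    have hhi : μ + m₀ ≤ μ₂ / 2 := by linarith only [hμ.2, hm2]
    -- Step 1: the admissible triples have `P₀ + Σ p(θ_ω)` close to `0`
    set r : ℝ := ((m : ℝ) + 3) * B.Dcell * w with hr
    have hr0 : 0 ≤ r := by positivity
    have hsub : (Finset.univ : Finset (Fin (sectorCount n) × Fin (sectorCount n) × Fin (sectorCount n))).filter
        (fun ω : Fin (sectorCount n) × Fin (sectorCount n) × Fin (sectorCount n) =>
          ∃ (kf : Fin m → Fin 2 → ℝ) (k : Fin 3 → Fin 2 → ℝ),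
          (∀ j i, |kf j i| < Real.pi) ∧ (∀ l i, |k l i| < Real.pi) ∧
          (∀ j, |sqDispersion (kf j) - μ| ≤ w) ∧ (∀ l, |sqDispersion (k l) - μ| ≤ w) ∧
          (∀ j, sectorIndex n (Complex.arg (⟨kf j 0, kf j 1⟩ : ℂ)) = ωf j) ∧
          sectorIndex n (Complex.arg (⟨k 0 0, k 0 1⟩ : ℂ)) = (ω.1 : ℕ) ∧
          sectorIndex n (Complex.arg (⟨k 1 0, k 1 1⟩ : ℂ)) = (ω.2.1 : ℕ) ∧
          sectorIndex n (Complex.arg (⟨k 2 0, k 2 1⟩ : ℂ)) = (ω.2.2 : ℕ) ∧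
          (∀ i, (∑ j, kf j i) + (∑ l, k l i) = 2 * Real.pi * (G i : ℝ))) ⊆
      (Finset.univ : Finset (Fin (sectorCount n) × Fin (sectorCount n) × Fin (sectorCount n))).filter
        (fun ω : Fin (sectorCount n) × Fin (sectorCount n) × Fin (sectorCount n) =>
        |P₀.1 + bandX μ (w / 2 + ((ω.1 : ℕ) : ℝ) * w) + bandX μ (w / 2 + ((ω.2.1 : ℕ) : ℝ) * w) +
            bandX μ (w / 2 + ((ω.2.2 : ℕ) : ℝ) * w)| ≤ r ∧
        |P₀.2 + bandY μ (w / 2 + ((ω.1 : ℕ) : ℝ) * w) + bandY μ (w / 2 + ((ω.2.1 : ℕ) : ℝ) * w) +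
            bandY μ (w / 2 + ((ω.2.2 : ℕ) : ℝ) * w)| ≤ r) := by
      intro ω hω
      rw [Finset.mem_filter] at hω
      obtain ⟨-, kf, k, hkf, hk, hshf, hsh, hif, hi0, hi1, hi2, hsum⟩ := hω
      have hwm' : sectorWidth n ≤ m₀ := by rw [hwdef]; exact hwm
      have cf : ∀ j, |kf j 0 - bandX μ (w / 2 + (ωf j : ℝ) * w)| ≤ B.Dcell * w ∧
          |kf j 1 - bandY μ (w / 2 + (ωf j : ℝ) * w)| ≤ B.Dcell * w := by
        intro j
        have c := cell B hμab (hkf j) (by rw [hwdef]; exact hshf j) hwm' hlo hhi (hif j)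
        rw [hsc, hwdef] at c
        exact c
      have c0 := cell B hμab (hk 0) (by rw [hwdef]; exact hsh 0) hwm' hlo hhi hi0
      have c1 := cell B hμab (hk 1) (by rw [hwdef]; exact hsh 1) hwm' hlo hhi hi1
      have c2 := cell B hμab (hk 2) (by rw [hwdef]; exact hsh 2) hwm' hlo hhi hi2
      rw [hsc, hwdef] at c0 c1 c2
      rw [Finset.mem_filter]
      refine ⟨Finset.mem_univ _, ?_, ?_⟩
      · have hs := hsum 0
        rw [Fin.sum_univ_three] at hs
        have hfix : |∑ j, (kf j 0 - bandX μ (w / 2 + (ωf j : ℝ) * w))| ≤ (m : ℝ) * (B.Dcell * w) := by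
          calc |∑ j, (kf j 0 - bandX μ (w / 2 + (ωf j : ℝ) * w))|
              ≤ ∑ j, |kf j 0 - bandX μ (w / 2 + (ωf j : ℝ) * w)| := Finset.abs_sum_le_sum_abs _ _
            _ ≤ ∑ _j : Fin m, B.Dcell * w := Finset.sum_le_sum fun j _ => (cf j).1
            _ = (m : ℝ) * (B.Dcell * w) := by rw [Finset.sum_const, Finset.card_univ, Fintype.card_fin, nsmul_eq_mul]
        have e : P₀.1 + bandX μ (w / 2 + ((ω.1 : ℕ) : ℝ) * w) + bandX μ (w / 2 + ((ω.2.1 : ℕ) : ℝ) * w) +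
            bandX μ (w / 2 + ((ω.2.2 : ℕ) : ℝ) * w) =
            -(∑ j, (kf j 0 - bandX μ (w / 2 + (ωf j : ℝ) * w))) +
            (-(k 0 0 - bandX μ (w / 2 + ((ω.1 : ℕ) : ℝ) * w)) + -(k 1 0 - bandX μ (w / 2 + ((ω.2.1 : ℕ) : ℝ) * w)) +
            -(k 2 0 - bandX μ (w / 2 + ((ω.2.2 : ℕ) : ℝ) * w))) := by
          rw [hP₀]; dsimp only
          rw [Finset.sum_sub_distrib]
          linear_combination hs
        rw [e]
        calc _ ≤ |-(∑ j, (kf j 0 - bandX μ (w / 2 + (ωf j : ℝ) * w)))| +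
              (|-(k 0 0 - bandX μ (w / 2 + ((ω.1 : ℕ) : ℝ) * w))| + |-(k 1 0 - bandX μ (w / 2 + ((ω.2.1 : ℕ) : ℝ) * w))| +
              |-(k 2 0 - bandX μ (w / 2 + ((ω.2.2 : ℕ) : ℝ) * w))|) := by
              refine (abs_add_le _ _).trans (add_le_add le_rfl ((abs_add_le _ _).trans (add_le_add (abs_add_le _ _) le_rfl)))
          _ ≤ (m : ℝ) * (B.Dcell * w) + (B.Dcell * w + B.Dcell * w + B.Dcell * w) := by
              rw [abs_neg, abs_neg, abs_neg, abs_neg]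
              exact add_le_add hfix (add_le_add (add_le_add c0.1 c1.1) c2.1)
          _ = r := by rw [hr]; ring
      · have hs := hsum 1
        rw [Fin.sum_univ_three] at hs
        have hfix : |∑ j, (kf j 1 - bandY μ (w / 2 + (ωf j : ℝ) * w))| ≤ (m : ℝ) * (B.Dcell * w) := by
          calc |∑ j, (kf j 1 - bandY μ (w / 2 + (ωf j : ℝ) * w))|
              ≤ ∑ j, |kf j 1 - bandY μ (w / 2 + (ωf j : ℝ) * w)| := Finset.abs_sum_le_sum_abs _ _
            _ ≤ ∑ _j : Fin m, B.Dcell * w := Finset.sum_le_sum fun j _ => (cf j).2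
            _ = (m : ℝ) * (B.Dcell * w) := by rw [Finset.sum_const, Finset.card_univ, Fintype.card_fin, nsmul_eq_mul]
        have e : P₀.2 + bandY μ (w / 2 + ((ω.1 : ℕ) : ℝ) * w) + bandY μ (w / 2 + ((ω.2.1 : ℕ) : ℝ) * w) +
            bandY μ (w / 2 + ((ω.2.2 : ℕ) : ℝ) * w) =
            -(∑ j, (kf j 1 - bandY μ (w / 2 + (ωf j : ℝ) * w))) +
            (-(k 0 1 - bandY μ (w / 2 + ((ω.1 : ℕ) : ℝ) * w)) + -(k 1 1 - bandY μ (w / 2 + ((ω.2.1 : ℕ) : ℝ) * w)) +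
            -(k 2 1 - bandY μ (w / 2 + ((ω.2.2 : ℕ) : ℝ) * w))) := by
          rw [hP₀]; dsimp only
          rw [Finset.sum_sub_distrib]
          linear_combination hs
        rw [e]
        calc _ ≤ |-(∑ j, (kf j 1 - bandY μ (w / 2 + (ωf j : ℝ) * w)))| +
              (|-(k 0 1 - bandY μ (w / 2 + ((ω.1 : ℕ) : ℝ) * w))| + |-(k 1 1 - bandY μ (w / 2 + ((ω.2.1 : ℕ) : ℝ) * w))| +
              |-(k 2 1 - bandY μ (w / 2 + ((ω.2.2 : ℕ) : ℝ) * w))|) := by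
              refine (abs_add_le _ _).trans (add_le_add le_rfl ((abs_add_le _ _).trans (add_le_add (abs_add_le _ _) le_rfl)))
          _ ≤ (m : ℝ) * (B.Dcell * w) + (B.Dcell * w + B.Dcell * w + B.Dcell * w) := by
              rw [abs_neg, abs_neg, abs_neg, abs_neg]
              exact add_le_add hfix (add_le_add (add_le_add c0.2 c1.2) c2.2)
          _ = r := by rw [hr]; ring
    -- Step 2: eliminate the last index
    have hT'le : ((((Finset.univ : Finset (Fin (sectorCount n) × Fin (sectorCount n) × Fin (sectorCount n))).filter
        (fun ω : Fin (sectorCount n) × Fin (sectorCount n) × Fin (sectorCount n) =>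
        |P₀.1 + bandX μ (w / 2 + ((ω.1 : ℕ) : ℝ) * w) + bandX μ (w / 2 + ((ω.2.1 : ℕ) : ℝ) * w) +
            bandX μ (w / 2 + ((ω.2.2 : ℕ) : ℝ) * w)| ≤ r ∧
        |P₀.2 + bandY μ (w / 2 + ((ω.1 : ℕ) : ℝ) * w) + bandY μ (w / 2 + ((ω.2.1 : ℕ) : ℝ) * w) +
            bandY μ (w / 2 + ((ω.2.2 : ℕ) : ℝ) * w)| ≤ r)).card : ℝ)) ≤
        C₀ * ((((Finset.range (sectorCount n) ×ˢ Finset.range (sectorCount n)).filter fun p : ℕ × ℕ =>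
          |eps2 (P₀.1 + bandX μ (w / 2 + p.1 * w) + bandX μ (w / 2 + p.2 * w))
            (P₀.2 + bandY μ (w / 2 + p.1 * w) + bandY μ (w / 2 + p.2 * w)) - μ| ≤ Cδ * w).card : ℝ)) := by
      refine card_prod3_le (N := sectorCount n)
        (Q := fun i c d => |P₀.1 + bandX μ (w / 2 + i * w) + bandX μ (w / 2 + c * w) + bandX μ (w / 2 + d * w)| ≤ r ∧
          |P₀.2 + bandY μ (w / 2 + i * w) + bandY μ (w / 2 + c * w) + bandY μ (w / 2 + d * w)| ≤ r)
        (R := fun i c => |eps2 (P₀.1 + bandX μ (w / 2 + i * w) + bandX μ (w / 2 + c * w))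
            (P₀.2 + bandY μ (w / 2 + i * w) + bandY μ (w / 2 + c * w)) - μ| ≤ Cδ * w) hC₀pos.le ?_ ?_
      · intro i c hi hc
        have hbox := card_grid_in_box_le B hμab hwpos hNw hr0 (N := sectorCount n)
          (x := -(P₀.1 + bandX μ (w / 2 + i * w) + bandX μ (w / 2 + c * w)))
          (y := -(P₀.2 + bandY μ (w / 2 + i * w) + bandY μ (w / 2 + c * w)))
        have heq : ((Finset.range (sectorCount n)).filter fun d : ℕ =>
            |P₀.1 + bandX μ (w / 2 + i * w) + bandX μ (w / 2 + c * w) + bandX μ (w / 2 + d * w)| ≤ r ∧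
            |P₀.2 + bandY μ (w / 2 + i * w) + bandY μ (w / 2 + c * w) + bandY μ (w / 2 + d * w)| ≤ r) =
            ((Finset.range (sectorCount n)).filter fun d : ℕ =>
            |bandX μ (w / 2 + d * w) - -(P₀.1 + bandX μ (w / 2 + i * w) + bandX μ (w / 2 + c * w))| ≤ r ∧
            |bandY μ (w / 2 + d * w) - -(P₀.2 + bandY μ (w / 2 + i * w) + bandY μ (w / 2 + c * w))| ≤ r) := by
          refine Finset.filter_congr fun d _ => ?_
          rw [show P₀.1 + bandX μ (w / 2 + i * w) + bandX μ (w / 2 + c * w) + bandX μ (w / 2 + d * w) =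
            bandX μ (w / 2 + d * w) - -(P₀.1 + bandX μ (w / 2 + i * w) + bandX μ (w / 2 + c * w)) by ring,
            show P₀.2 + bandY μ (w / 2 + i * w) + bandY μ (w / 2 + c * w) + bandY μ (w / 2 + d * w) =
            bandY μ (w / 2 + d * w) - -(P₀.2 + bandY μ (w / 2 + i * w) + bandY μ (w / 2 + c * w)) by ring]
        rw [heq]
        refine hbox.trans (le_of_eq ?_)
        rw [hC₀, hr]; field_simp
      · intro i c d hi hc hd hQ
        have := h10_abs_offsetLevel_le_of_sum B hμab hQ.1 hQ.2
        have e : 4 * r = Cδ * w := by rw [hr, hCδ]; ring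
        linarith
    -- Step 3: the two-dimensional count with the offset `P₀`
    have hP := hcount μ hμab hlo hhi P₀ w (sectorCount n) (2 ^ n) n hwpos hw1 hNw
      (by push_cast; exact h2n) hNeq h2n h2δ
    clear hcount
    -- Step 4: arithmetic
    have hlogN : Real.log (sectorCount n : ℕ) ≤ (n : ℝ) + 1 := by rw [hNreal]; exact log_two_mul_two_pow_le n
    have hwinv : 1 / w = 2 ^ n / π := by rw [← h2n]; field_simp
    have e1 := Finset.card_le_card hsub
    have e1' : ((((Finset.univ : Finset (Fin (sectorCount n) × Fin (sectorCount n) × Fin (sectorCount n))).filter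
        (fun ω : Fin (sectorCount n) × Fin (sectorCount n) × Fin (sectorCount n) =>
          ∃ (kf : Fin m → Fin 2 → ℝ) (k : Fin 3 → Fin 2 → ℝ),
          (∀ j i, |kf j i| < Real.pi) ∧ (∀ l i, |k l i| < Real.pi) ∧
          (∀ j, |sqDispersion (kf j) - μ| ≤ w) ∧ (∀ l, |sqDispersion (k l) - μ| ≤ w) ∧
          (∀ j, sectorIndex n (Complex.arg (⟨kf j 0, kf j 1⟩ : ℂ)) = ωf j) ∧
          sectorIndex n (Complex.arg (⟨k 0 0, k 0 1⟩ : ℂ)) = (ω.1 : ℕ) ∧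
          sectorIndex n (Complex.arg (⟨k 1 0, k 1 1⟩ : ℂ)) = (ω.2.1 : ℕ) ∧
          sectorIndex n (Complex.arg (⟨k 2 0, k 2 1⟩ : ℂ)) = (ω.2.2 : ℕ) ∧
          (∀ i, (∑ j, kf j i) + (∑ l, k l i) = 2 * Real.pi * (G i : ℝ)))).card : ℝ)) ≤
        K₂ * 2 ^ n * ((n : ℝ) + 1) := by
      have e2 : Kp * ((n : ℝ) + 2 + Real.log (sectorCount n : ℕ)) / w ≤ Kp * (3 * ((n : ℝ) + 1)) / w := by
        apply div_le_div_of_nonneg_right _ hwpos.le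
        apply mul_le_mul_of_nonneg_left _ hKp.le
        linarith only [hlogN]
      have e3 : Kp * (3 * ((n : ℝ) + 1)) / w = Kp * 3 / π * 2 ^ n * ((n : ℝ) + 1) := by
        rw [div_eq_mul_one_div _ w, hwinv]; ring
      have e4 : C₀ * (Kp * 3 / π * 2 ^ n * ((n : ℝ) + 1)) = K₂ * 2 ^ n * ((n : ℝ) + 1) := by rw [hK₂]; ring
      calc _ ≤ _ := by exact_mod_cast e1
        _ ≤ C₀ * (Kp * ((n : ℝ) + 2 + Real.log (sectorCount n : ℕ)) / w) := hT'le.trans (mul_le_mul_of_nonneg_left hP hC₀pos.le)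
        _ ≤ C₀ * (Kp * (3 * ((n : ℝ) + 1)) / w) := mul_le_mul_of_nonneg_left e2 hC₀pos.le
        _ = K₂ * 2 ^ n * ((n : ℝ) + 1) := by rw [e3, e4]
    refine e1'.trans ?_
    have : 0 ≤ K₁ * 2 ^ n * ((n : ℝ) + 1) := by positivity
    linarith only [this]
  · -- small `n`: `2ⁿ < π / w₀`
    clear hcount
    push Not at hwle
    have h2nlt : (2 : ℝ) ^ n ≤ π / w₀ := by
      rw [le_div_iff₀ hw₀pos, ← h2n]
      exact mul_le_mul_of_nonneg_left hwle.le h2npos.le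
    have hbound : (sectorCount n : ℝ) ^ 3 ≤ K₁ * 2 ^ n := by
      rw [hNreal, hK₁]
      have hsq : ((2 : ℝ) ^ n) ^ 2 ≤ (π / w₀) ^ 2 := pow_le_pow_left₀ h2npos.le h2nlt 2
      have e : (2 * (2 : ℝ) ^ n) ^ 3 = 8 * ((2 : ℝ) ^ n) ^ 2 * 2 ^ n := by ring
      rw [e]
      exact mul_le_mul_of_nonneg_right (mul_le_mul_of_nonneg_left hsq (by norm_num)) h2npos.le
    refine (htriv _).trans (hbound.trans ?_)
    have h1 : K₁ * 2 ^ n ≤ (K₁ + K₂) * 2 ^ n := mul_le_mul_of_nonneg_right (by linarith only [hK₂pos]) h2npos.le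
    have h2 : (K₁ + K₂) * 2 ^ n ≤ (K₁ + K₂) * 2 ^ n * ((n : ℝ) + 1) :=
      le_mul_of_one_le_right (by positivity) (by linarith only [(by positivity : (0:ℝ) ≤ n)])
    linarith only [h1, h2]

end Summit.HubbardSuperconductivity.HubbardSuperconductivity.Theorems

end
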